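import Literature.AnabelianGeometry.SemiGraphs.WitnessIwahoriLoop
import Mathlib.NumberTheory.Padics.RingHoms
import Mathlib.RingTheory.Nilpotent.Basic
import Mathlib.Topology.MetricSpace.Ultra.Basic
import HarnessLib

/-!
# The estranged loop `𝒢₁`, part 2: finite approximators — quasi-coherence and total elevation

Witness file of the abc-iut cell (layer L3, row WIT-1b, part 2; companion of `WitnessIwahoriLoop`).
Source of the hypotheses: S. Mochizuki, *Semi-graphs of anabelioids*, Publ. RIMS **42** (2006), Def. 2.3
(i)–(iii) pp. 24–25 (approximators, quasi-coherent), Def. 2.4 (i) p. 25 (elevated vertices).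

For every level `n` the vertex group `P = ℤ_p ⋊ (1 + pℤ_p)` of `𝒢₁` surjects onto the FINITE group
`P_n := (ℤ/pⁿ) ⋊ (image of 1 + pℤ_p)` (`IwMod p n`, the same coordinates `(a, s)` read modulo `pⁿ`), the edge
group `U` onto `U_n` (`IwUMod p n`), compatibly with the two branch maps `s ↦ (c s, s)`, `c ∈ {0, 1}`
(conjugator `g = 1`): this is the approximator `approx p n` of `𝒢₁` (Def. 2.3 (i)(ii), of injective type and
`π₁`-epimorphic). Consequences kernel-checked here:

* `loopGraph_isQuasiCoherent` — a finite continuous `P`-set (resp. `U`-set) is acted on trivially by the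
  level-`n` kernel for `n` large (stabilisers are open; open subgroups of `P` contain a level box);
* `loopGraph_isTotallyElevated` — in `P_n` the translation subgroup `N = {(a, 0)}` has order `pⁿ ≥ n + 1`
  and meets every conjugate of either branch image `{(c s, s)}` trivially (a conjugate of a graph is a
  graph, whose only element with `s = 0` is `1`).

Deliberately NOT here: Galois-countability and the assembled bundles (part 3). No side is taken on
[IUTchIII] Cor. 3.12. [cite: MochizukiSemiAnbd2006, Def 2.3-2.4 pp.24-26]
-/

noncomputable section

open Topology

namespace Literature.AnabelianGeometry.SemiGraphs

open IwahoriWitness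

variable (p : ℕ) [Fact p.Prime] (n : ℕ)

/-! ## 1. The finite levels `U_n`, `P_n` -/

namespace IwahoriWitness

/-- `w̄ s := 1 + p s` in `ℤ/pⁿ`. [cite: MochizukiSemiAnbd2006, Def 2.3(i) p.24] -/
def wMod (s : ZMod (p ^ n)) : ZMod (p ^ n) := 1 + (p : ZMod (p ^ n)) * s

omit [Fact p.Prime] in
/-- `1 + p s` is a unit of `ℤ/pⁿ` (`p s` is nilpotent). [cite: MochizukiSemiAnbd2006, Def 2.3(i) p.24] -/
theorem isUnit_wMod (s : ZMod (p ^ n)) : IsUnit (wMod p n s) := by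
  unfold wMod
  refine IsNilpotent.isUnit_one_add ⟨n, ?_⟩
  rw [mul_pow, ← Nat.cast_pow, ZMod.natCast_self, zero_mul]

/-- `(1 + p s)⁻¹` in `ℤ/pⁿ`. [cite: MochizukiSemiAnbd2006, Def 2.3(i) p.24] -/
def winvMod (s : ZMod (p ^ n)) : ZMod (p ^ n) := Ring.inverse (wMod p n s)

omit [Fact p.Prime] in
/-- `(1 + p s)⁻¹ (1 + p s) = 1` in `ℤ/pⁿ`. [cite: MochizukiSemiAnbd2006, Def 2.3(i) p.24] -/
@[simp] theorem winvMod_mul_wMod (s : ZMod (p ^ n)) : winvMod p n s * wMod p n s = 1 :=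
  Ring.inverse_mul_cancel _ (isUnit_wMod p n s)

omit [Fact p.Prime] in
/-- `(1 + p s)(1 + p t) = 1 + p (s + t + p s t)` in `ℤ/pⁿ`. [cite: MochizukiSemiAnbd2006, Def 2.3(i) p.24] -/
theorem wMod_mul_wMod (s t : ZMod (p ^ n)) :
    wMod p n s * wMod p n t = wMod p n (s + t + (p : ZMod (p ^ n)) * s * t) := by
  unfold wMod; ring

end IwahoriWitness

/-- The finite level `U_n` of `U = 1 + pℤ_p`: coordinate `s ∈ ℤ/pⁿ`, law `s ∗ t = s + t + p s t`.
[cite: MochizukiSemiAnbd2006, Def 2.3(i) p.24] -/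
@[ext] structure IwUMod (p : ℕ) [Fact p.Prime] (n : ℕ) : Type where
  /-- the coordinate -/
  s : ZMod (p ^ n)

namespace IwUMod

variable {p n}

/-- Multiplication of `U_n`. [cite: MochizukiSemiAnbd2006, Def 2.3(i) p.24] -/
instance : Mul (IwUMod p n) := ⟨fun x y => ⟨x.s + y.s + (p : ZMod (p ^ n)) * x.s * y.s⟩⟩
/-- Unit of `U_n`. [cite: MochizukiSemiAnbd2006, Def 2.3(i) p.24] -/
instance : One (IwUMod p n) := ⟨⟨0⟩⟩
/-- Inversion of `U_n`. [cite: MochizukiSemiAnbd2006, Def 2.3(i) p.24] -/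
instance : Inv (IwUMod p n) := ⟨fun x => ⟨-x.s * winvMod p n x.s⟩⟩

/-- Coordinate of a product. [cite: MochizukiSemiAnbd2006, Def 2.3(i) p.24] -/
@[simp] theorem mul_s (x y : IwUMod p n) : (x * y).s = x.s + y.s + (p : ZMod (p ^ n)) * x.s * y.s := rfl
/-- Coordinate of the unit. [cite: MochizukiSemiAnbd2006, Def 2.3(i) p.24] -/
@[simp] theorem one_s : (1 : IwUMod p n).s = 0 := rfl
/-- Coordinate of an inverse. [cite: MochizukiSemiAnbd2006, Def 2.3(i) p.24] -/
@[simp] theorem inv_s (x : IwUMod p n) : x⁻¹.s = -x.s * winvMod p n x.s := rfl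

/-- `U_n` is a group. [cite: MochizukiSemiAnbd2006, Def 2.3(i) p.24] -/
instance : Group (IwUMod p n) where
  mul_assoc x y z := by ext; simp only [mul_s]; ring
  one_mul x := by ext; simp
  mul_one x := by ext; simp
  inv_mul_cancel x := by
    ext
    simp only [mul_s, inv_s, one_s]
    have h := winvMod_mul_wMod p n x.s
    unfold wMod at h
    linear_combination (-x.s) * h

/-- `U_n ≃ ℤ/pⁿ` as sets. [cite: MochizukiSemiAnbd2006, Def 2.3(i) p.24] -/
def equivZMod : IwUMod p n ≃ ZMod (p ^ n) := ⟨fun x => x.s, fun s => ⟨s⟩, fun _ => rfl, fun _ => rfl⟩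

/-- `U_n` is finite. [cite: MochizukiSemiAnbd2006, Def 2.3(i) p.24] -/
instance : Finite (IwUMod p n) :=
  haveI : NeZero (p ^ n) := ⟨pow_ne_zero _ (Fact.out : p.Prime).ne_zero⟩
  Finite.of_equiv _ (equivZMod (p := p) (n := n)).symm

end IwUMod

/-- The finite level `P_n` of `P = ℤ_p ⋊ (1 + pℤ_p)`: coordinates `(a, s) ∈ (ℤ/pⁿ)²`, law
`(a, s)(b, t) = (a + (1 + p s) b, s + t + p s t)`. [cite: MochizukiSemiAnbd2006, Def 2.3(i) p.24] -/
@[ext] structure IwMod (p : ℕ) [Fact p.Prime] (n : ℕ) : Type where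
  /-- translation coordinate -/
  a : ZMod (p ^ n)
  /-- unit coordinate -/
  s : ZMod (p ^ n)

namespace IwMod

variable {p n}

/-- Multiplication of `P_n`. [cite: MochizukiSemiAnbd2006, Def 2.3(i) p.24] -/
instance : Mul (IwMod p n) :=
  ⟨fun x y => ⟨x.a + wMod p n x.s * y.a, x.s + y.s + (p : ZMod (p ^ n)) * x.s * y.s⟩⟩
/-- Unit of `P_n`. [cite: MochizukiSemiAnbd2006, Def 2.3(i) p.24] -/
instance : One (IwMod p n) := ⟨⟨0, 0⟩⟩
/-- Inversion of `P_n`. [cite: MochizukiSemiAnbd2006, Def 2.3(i) p.24] -/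
instance : Inv (IwMod p n) := ⟨fun x => ⟨-(winvMod p n x.s * x.a), -x.s * winvMod p n x.s⟩⟩

/-- Coordinates of a product. [cite: MochizukiSemiAnbd2006, Def 2.3(i) p.24] -/
@[simp] theorem mul_a (x y : IwMod p n) : (x * y).a = x.a + wMod p n x.s * y.a := rfl
/-- Coordinates of a product. [cite: MochizukiSemiAnbd2006, Def 2.3(i) p.24] -/
@[simp] theorem mul_s (x y : IwMod p n) : (x * y).s = x.s + y.s + (p : ZMod (p ^ n)) * x.s * y.s := rfl
/-- Coordinates of the unit. [cite: MochizukiSemiAnbd2006, Def 2.3(i) p.24] -/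
@[simp] theorem one_a : (1 : IwMod p n).a = 0 := rfl
/-- Coordinates of the unit. [cite: MochizukiSemiAnbd2006, Def 2.3(i) p.24] -/
@[simp] theorem one_s : (1 : IwMod p n).s = 0 := rfl
/-- Coordinates of an inverse. [cite: MochizukiSemiAnbd2006, Def 2.3(i) p.24] -/
@[simp] theorem inv_a (x : IwMod p n) : x⁻¹.a = -(winvMod p n x.s * x.a) := rfl
/-- Coordinates of an inverse. [cite: MochizukiSemiAnbd2006, Def 2.3(i) p.24] -/
@[simp] theorem inv_s (x : IwMod p n) : x⁻¹.s = -x.s * winvMod p n x.s := rfl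

/-- `P_n` is a group. [cite: MochizukiSemiAnbd2006, Def 2.3(i) p.24] -/
instance : Group (IwMod p n) where
  mul_assoc x y z := by
    ext
    · simp only [mul_a, mul_s]
      rw [← wMod_mul_wMod]; ring
    · simp only [mul_s]; ring
  one_mul x := by ext <;> simp [wMod]
  mul_one x := by ext <;> simp
  inv_mul_cancel x := by
    ext
    · simp only [mul_a, inv_a, inv_s, one_a]
      have h := winvMod_mul_wMod p n x.s
      unfold wMod at h ⊢
      linear_combination (-x.a) * h
    · simp only [mul_s, inv_s, one_s]
      have h := winvMod_mul_wMod p n x.s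
      unfold wMod at h
      linear_combination (-x.s) * h

/-- `P_n ≃ (ℤ/pⁿ)²` as sets. [cite: MochizukiSemiAnbd2006, Def 2.3(i) p.24] -/
def equivProd : IwMod p n ≃ ZMod (p ^ n) × ZMod (p ^ n) :=
  ⟨fun x => (x.a, x.s), fun q => ⟨q.1, q.2⟩, fun _ => rfl, fun _ => rfl⟩

/-- `P_n` is finite. [cite: MochizukiSemiAnbd2006, Def 2.3(i) p.24] -/
instance : Finite (IwMod p n) :=
  haveI : NeZero (p ^ n) := ⟨pow_ne_zero _ (Fact.out : p.Prime).ne_zero⟩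
  Finite.of_equiv _ (equivProd (p := p) (n := n)).symm

/-- The conjugation formula of `P_n`. [cite: MochizukiSemiAnbd2006, Def 2.4(i) p.25] -/
theorem conj_coords (x y : IwMod p n) :
    (x * y * x⁻¹).s = y.s ∧ (x * y * x⁻¹).a = -((p : ZMod (p ^ n)) * y.s * x.a) + wMod p n x.s * y.a := by
  have hxs := winvMod_mul_wMod p n x.s
  have hmul : wMod p n (x * y).s = wMod p n x.s * wMod p n y.s := by rw [mul_s, wMod_mul_wMod]
  constructor
  · simp only [mul_s, inv_s]
    unfold wMod at hxs
    linear_combination (-(x.s * (1 + (p : ZMod (p ^ n)) * y.s))) * hxs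
  · simp only [mul_a, inv_a]
    rw [hmul]
    unfold wMod at hxs ⊢
    linear_combination (-((1 + (p : ZMod (p ^ n)) * y.s) * x.a)) * hxs

/-- The branch map `U_n → P_n`, `s ↦ (c s, s)`, at level `n`. [cite: MochizukiSemiAnbd2006, Def 2.3(i) p.24] -/
def brMod (c : ZMod (p ^ n)) : IwUMod p n →* IwMod p n where
  toFun x := ⟨c * x.s, x.s⟩
  map_one' := by ext <;> simp
  map_mul' x y := by
    ext
    · simp only [IwUMod.mul_s, mul_a, wMod]; ring
    · simp only [IwUMod.mul_s, mul_s]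

/-- `brMod c` is injective (the approximator is of injective type). [cite: MochizukiSemiAnbd2006, Def 2.3(i) p.24] -/
theorem brMod_injective (c : ZMod (p ^ n)) : Function.Injective (brMod (p := p) (n := n) c) :=
  fun x y h => by ext; simpa [brMod] using congrArg IwMod.s h

/-- Elements of the image of `brMod c` are graphs: `a = c s`. [cite: MochizukiSemiAnbd2006, Def 2.3(i) p.24] -/
theorem a_eq_of_mem_range_brMod {c : ZMod (p ^ n)} {y : IwMod p n} (hy : y ∈ (brMod c).range) :
    y.a = c * y.s := by
  obtain ⟨x, rfl⟩ := hy; rfl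

/-- The translation subgroup `N = {(a, 0)}` of `P_n`. [cite: MochizukiSemiAnbd2006, Def 2.4(i) p.25] -/
def transl : Subgroup (IwMod p n) where
  carrier := {x | x.s = 0}
  mul_mem' := by intro x y hx hy; simp only [Set.mem_setOf_eq, mul_s] at *; rw [hx, hy]; ring
  one_mem' := rfl
  inv_mem' := by intro x hx; simp only [Set.mem_setOf_eq, inv_s] at *; rw [hx]; ring

/-- `N` has `pⁿ` elements. [cite: MochizukiSemiAnbd2006, Def 2.4(i) p.25] -/
theorem card_transl : Nat.card (transl (p := p) (n := n)) = p ^ n := by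
  have e : transl (p := p) (n := n) ≃ ZMod (p ^ n) :=
    ⟨fun x => x.1.a, fun a => ⟨⟨a, 0⟩, rfl⟩, fun x => by
      rcases x with ⟨⟨a, s⟩, hs⟩; simp only [transl, Subgroup.mem_mk] at hs; subst hs; rfl,
      fun _ => rfl⟩
  rw [Nat.card_congr e, Nat.card_zmod]

/-- `N` meets every conjugate of a branch image trivially. [cite: MochizukiSemiAnbd2006, Def 2.4(i) p.25] -/
theorem transl_inf_conj_range_brMod (c : ZMod (p ^ n)) (g : IwMod p n) :
    transl ⊓ ((brMod c).range.map (MulAut.conj g).toMonoidHom) = ⊥ := by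
  rw [eq_bot_iff]
  rintro z ⟨hz, ⟨y, hy, rfl⟩⟩
  rw [Subgroup.mem_bot]
  have hs : (g * y * g⁻¹).s = y.s := (conj_coords g y).1
  have hz' : (g * y * g⁻¹).s = 0 := hz
  have hys : y.s = 0 := by rw [← hs]; exact hz'
  have hya : y.a = 0 := by rw [a_eq_of_mem_range_brMod hy, hys, mul_zero]
  have hy1 : y = 1 := by ext <;> simp [hys, hya]
  show (MulAut.conj g) y = 1
  rw [hy1, map_one]

end IwMod

/-! ## 2. The reductions `U → U_n`, `P → P_n` -/

namespace IwU

variable {p}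

/-- The reduction `U → U_n` (coordinatewise `ℤ_p → ℤ/pⁿ`). [cite: MochizukiSemiAnbd2006, Def 2.3(i) p.24] -/
def toMod (n : ℕ) : IwU p →* IwUMod p n where
  toFun x := ⟨PadicInt.toZModPow n x.s⟩
  map_one' := by ext; simp
  map_mul' x y := by ext; simp

/-- Coordinate of the reduction. [cite: MochizukiSemiAnbd2006, Def 2.3(i) p.24] -/
@[simp] theorem toMod_s (x : IwU p) : (toMod n x).s = PadicInt.toZModPow n x.s := rfl

/-- The reduction `U → U_n` is onto. [cite: MochizukiSemiAnbd2006, Def 2.3(ii) p.25] -/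
theorem toMod_surjective : Function.Surjective (toMod (p := p) n) := by
  haveI : NeZero (p ^ n) := ⟨pow_ne_zero _ (Fact.out : p.Prime).ne_zero⟩
  intro y
  refine ⟨⟨(y.s.val : ℤ_[p])⟩, ?_⟩
  ext; simp

/-- The kernel of `U → U_n` is the level-`n` box `{‖s‖ ≤ p⁻ⁿ}`. [cite: MochizukiSemiAnbd2006, Def 2.3(i) p.24] -/
theorem toMod_eq_one_iff (x : IwU p) : toMod n x = 1 ↔ ‖x.s‖ ≤ (p : ℝ) ^ (-(n : ℤ)) := by
  rw [PadicInt.norm_le_pow_iff_mem_span_pow, ← PadicInt.ker_toZModPow, RingHom.mem_ker]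
  constructor
  · intro h; exact congrArg IwUMod.s h
  · intro h; ext; exact h

/-- The kernel of `U → U_n` is open. [cite: MochizukiSemiAnbd2006, Def 2.3(i) p.24] -/
theorem isOpen_ker_toMod : IsOpen ((toMod (p := p) n).ker : Set (IwU p)) := by
  have hset : ((toMod (p := p) n).ker : Set (IwU p)) =
      (fun x : IwU p => x.s) ⁻¹' Metric.closedBall 0 ((p : ℝ) ^ (-(n : ℤ))) := by
    ext x
    rw [SetLike.mem_coe, MonoidHom.mem_ker, toMod_eq_one_iff, Set.mem_preimage, Metric.mem_closedBall,
      dist_zero_right]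
  rw [hset]
  exact (IsUltrametricDist.isOpen_closedBall _ (ne_of_gt (zpow_pos (by exact_mod_cast (Fact.out : p.Prime).pos) _))).preimage continuous_s

end IwU

namespace Iw

variable {p}

/-- The reduction `P → P_n`. [cite: MochizukiSemiAnbd2006, Def 2.3(i) p.24] -/
def toMod (n : ℕ) : Iw p →* IwMod p n where
  toFun x := ⟨PadicInt.toZModPow n x.a, PadicInt.toZModPow n x.s⟩
  map_one' := by ext <;> simp
  map_mul' x y := by ext <;> simp [w, wMod]

/-- Coordinates of the reduction. [cite: MochizukiSemiAnbd2006, Def 2.3(i) p.24] -/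
@[simp] theorem toMod_a (x : Iw p) : (toMod n x).a = PadicInt.toZModPow n x.a := rfl
/-- Coordinates of the reduction. [cite: MochizukiSemiAnbd2006, Def 2.3(i) p.24] -/
@[simp] theorem toMod_s (x : Iw p) : (toMod n x).s = PadicInt.toZModPow n x.s := rfl

/-- The reduction `P → P_n` is onto. [cite: MochizukiSemiAnbd2006, Def 2.3(ii) p.25] -/
theorem toMod_surjective : Function.Surjective (toMod (p := p) n) := by
  haveI : NeZero (p ^ n) := ⟨pow_ne_zero _ (Fact.out : p.Prime).ne_zero⟩
  intro y
  refine ⟨⟨(y.a.val : ℤ_[p]), (y.s.val : ℤ_[p])⟩, ?_⟩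
  ext <;> simp

/-- The kernel of `P → P_n` is the level-`n` box. [cite: MochizukiSemiAnbd2006, Def 2.3(i) p.24] -/
theorem toMod_eq_one_iff (x : Iw p) :
    toMod n x = 1 ↔ ‖x.a‖ ≤ (p : ℝ) ^ (-(n : ℤ)) ∧ ‖x.s‖ ≤ (p : ℝ) ^ (-(n : ℤ)) := by
  rw [PadicInt.norm_le_pow_iff_mem_span_pow, PadicInt.norm_le_pow_iff_mem_span_pow,
    ← PadicInt.ker_toZModPow, RingHom.mem_ker, RingHom.mem_ker]
  constructor
  · intro h; exact ⟨congrArg IwMod.a h, congrArg IwMod.s h⟩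
  · rintro ⟨ha, hs⟩; ext; exacts [ha, hs]

/-- The kernel of `P → P_n` is open. [cite: MochizukiSemiAnbd2006, Def 2.3(i) p.24] -/
theorem isOpen_ker_toMod : IsOpen ((toMod (p := p) n).ker : Set (Iw p)) := by
  have hset : ((toMod (p := p) n).ker : Set (Iw p)) =
      (fun x : Iw p => x.a) ⁻¹' Metric.closedBall 0 ((p : ℝ) ^ (-(n : ℤ))) ∩
        (fun x : Iw p => x.s) ⁻¹' Metric.closedBall 0 ((p : ℝ) ^ (-(n : ℤ))) := by
    ext x
    rw [SetLike.mem_coe, MonoidHom.mem_ker, toMod_eq_one_iff]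
    simp only [Set.mem_inter_iff, Set.mem_preimage, Metric.mem_closedBall, dist_zero_right]
  rw [hset]
  exact ((IsUltrametricDist.isOpen_closedBall _ (ne_of_gt (zpow_pos (by exact_mod_cast (Fact.out : p.Prime).pos) _))).preimage continuous_a).inter
    ((IsUltrametricDist.isOpen_closedBall _ (ne_of_gt (zpow_pos (by exact_mod_cast (Fact.out : p.Prime).pos) _))).preimage continuous_s)

/-- A neighbourhood of `1` in `P` contains a level box. [cite: MochizukiSemiAnbd2006, Def 2.3(iii) p.25] -/
theorem exists_level_subset_of_mem_nhds {V : Set (Iw p)} (hV : V ∈ 𝓝 (1 : Iw p)) :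
    ∃ n : ℕ, ∀ g : Iw p, toMod n g = 1 → g ∈ V := by
  have hcont : Continuous fun q : ℤ_[p] × ℤ_[p] => (⟨q.1, q.2⟩ : Iw p) :=
    (continuous_mk_iff (p := p)).2 ⟨continuous_fst, continuous_snd⟩
  have h2 : (fun q : ℤ_[p] × ℤ_[p] => (⟨q.1, q.2⟩ : Iw p)) ⁻¹' V ∈ 𝓝 ((0 : ℤ_[p]), (0 : ℤ_[p])) :=
    hcont.continuousAt.preimage_mem_nhds (by exact hV)
  rw [Metric.mem_nhds_iff] at h2
  obtain ⟨ε, hε, hball⟩ := h2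
  have hp : (1 : ℝ) < p := by exact_mod_cast (Fact.out : p.Prime).one_lt
  obtain ⟨n, hn⟩ := exists_pow_lt_of_lt_one hε (inv_lt_one_of_one_lt₀ hp)
  refine ⟨n, fun g hg => ?_⟩
  rw [toMod_eq_one_iff] at hg
  have hlt : (p : ℝ) ^ (-(n : ℤ)) < ε := by rw [zpow_neg, zpow_natCast, ← inv_pow]; exact hn
  have hm : ((g.a, g.s) : ℤ_[p] × ℤ_[p]) ∈ Metric.ball ((0 : ℤ_[p]), (0 : ℤ_[p])) ε := by
    rw [Metric.mem_ball, Prod.dist_eq, dist_zero_right, dist_zero_right]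
    exact max_lt (hg.1.trans_lt hlt) (hg.2.trans_lt hlt)
  exact hball hm

/-- Levels are nested: the level-`m` box lies in the level-`n` box for `n ≤ m`.
[cite: MochizukiSemiAnbd2006, Def 2.3(iii) p.25] -/
theorem toMod_eq_one_mono {n m : ℕ} (h : n ≤ m) (g : Iw p) (hg : toMod m g = 1) : toMod n g = 1 := by
  rw [toMod_eq_one_iff] at hg ⊢
  have hp : (1 : ℝ) ≤ p := by exact_mod_cast (Fact.out : p.Prime).one_lt.le
  have hle : (p : ℝ) ^ (-(m : ℤ)) ≤ (p : ℝ) ^ (-(n : ℤ)) :=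
    zpow_le_zpow_right₀ hp (by omega)
  exact ⟨hg.1.trans hle, hg.2.trans hle⟩

end Iw

namespace IwU

variable {p}

/-- A neighbourhood of `1` in `U` contains a level box. [cite: MochizukiSemiAnbd2006, Def 2.3(iii) p.25] -/
theorem exists_level_subset_of_mem_nhds {V : Set (IwU p)} (hV : V ∈ 𝓝 (1 : IwU p)) :
    ∃ n : ℕ, ∀ g : IwU p, toMod n g = 1 → g ∈ V := by
  have hcont : Continuous fun s : ℤ_[p] => (⟨s⟩ : IwU p) := (continuous_mk_iff (p := p)).2 continuous_id
  have h2 : (fun s : ℤ_[p] => (⟨s⟩ : IwU p)) ⁻¹' V ∈ 𝓝 (0 : ℤ_[p]) :=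
    hcont.continuousAt.preimage_mem_nhds (by exact hV)
  rw [Metric.mem_nhds_iff] at h2
  obtain ⟨ε, hε, hball⟩ := h2
  have hp : (1 : ℝ) < p := by exact_mod_cast (Fact.out : p.Prime).one_lt
  obtain ⟨n, hn⟩ := exists_pow_lt_of_lt_one hε (inv_lt_one_of_one_lt₀ hp)
  refine ⟨n, fun g hg => ?_⟩
  rw [toMod_eq_one_iff] at hg
  have hlt : (p : ℝ) ^ (-(n : ℤ)) < ε := by rw [zpow_neg, zpow_natCast, ← inv_pow]; exact hn
  have hm : g.s ∈ Metric.ball (0 : ℤ_[p]) ε := by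
    rw [Metric.mem_ball, dist_zero_right]; exact hg.trans_lt hlt
  exact hball hm

/-- Levels are nested. [cite: MochizukiSemiAnbd2006, Def 2.3(iii) p.25] -/
theorem toMod_eq_one_mono {n m : ℕ} (h : n ≤ m) (g : IwU p) (hg : toMod m g = 1) : toMod n g = 1 := by
  rw [toMod_eq_one_iff] at hg ⊢
  have hp : (1 : ℝ) ≤ p := by exact_mod_cast (Fact.out : p.Prime).one_lt.le
  exact hg.trans (zpow_le_zpow_right₀ hp (by omega))

end IwU

/-! ## 3. The approximators of `𝒢₁` -/

namespace IwahoriWitness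

/-- The coefficient of a branch, read in `ℤ/pⁿ`. [cite: MochizukiSemiAnbd2006, Def 2.3(i) p.24] -/
def coeffMod (b : (SemiGraph.bouquet.{0} 1).Branch) : ZMod (p ^ n) := if b.down.2 then 1 else 0

/-- The reductions respect the coefficients `{0, 1}`. [cite: MochizukiSemiAnbd2006, Def 2.3(i) p.24] -/
theorem toZModPow_coeff (b : (SemiGraph.bouquet.{0} 1).Branch) :
    PadicInt.toZModPow n (coeff p b) = coeffMod p n b := by
  unfold coeff coeffMod; split_ifs <;> simp

/-- **The level-`n` approximator of `𝒢₁`** (Def. 2.3 (i)(ii)): finite groups `P_n`, `U_n`, the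
reductions, the branch maps `s ↦ (c s, s)` mod `pⁿ` (injective), compatible with the `b_c` on the nose
(`g = 1`), of bounded order `|P_n|`. [cite: MochizukiSemiAnbd2006, Def 2.3(i) p.24] -/
def approx : (loopGraph p).Approximator where
  FV _ := IwMod p n
  FE _ := IwUMod p n
  πV _ := Iw.toMod n
  πE _ := IwU.toMod n
  isOpen_ker_πV _ := Iw.isOpen_ker_toMod n
  isOpen_ker_πE _ := IwU.isOpen_ker_toMod n
  brF b _ _ := IwMod.brMod (coeffMod p n b)
  brF_injective b _ _ := IwMod.brMod_injective _
  comm b v h := ⟨1, fun x => by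
    rw [one_mul, inv_one, mul_one]
    ext
    · show coeffMod p n b * PadicInt.toZModPow n x.s = PadicInt.toZModPow n (coeff p b * x.s)
      rw [map_mul, toZModPow_coeff]
    · rfl⟩
  bounded := ⟨Nat.card (IwMod p n), Nat.card_pos, fun _ => dvd_rfl⟩

/-- The approximators are `π₁`-epimorphic. [cite: MochizukiSemiAnbd2006, Def 2.3(ii) p.25] -/
theorem approx_isPiOneEpimorphic : (approx p n).IsPiOneEpimorphic :=
  ⟨fun _ => Iw.toMod_surjective n, fun _ => IwU.toMod_surjective n⟩

/-! ## 4. Quasi-coherence and total elevation -/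

/-- The kernel of the action of `P` on a FINITE object of `B^temp(P)` contains a level box.
[cite: MochizukiSemiAnbd2006, Def 2.3(iii) p.25] -/
theorem exists_level_acts_trivially_V (X : BTemp (Iw p)) [Finite X.obj.V] :
    ∃ n : ℕ, ∀ g : Iw p, Iw.toMod n g = 1 → ∀ x : X.obj.V, X.obj.ρ g x = x := by
  have hopen : IsOpen {g : Iw p | ∀ x : X.obj.V, X.obj.ρ g x = x} := by
    have : {g : Iw p | ∀ x : X.obj.V, X.obj.ρ g x = x} = ⋂ x : X.obj.V, {g : Iw p | X.obj.ρ g x = x} := by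
      ext g; simp
    rw [this]
    exact isOpen_iInter_of_finite fun x => X.property.2 x
  have h1 : {g : Iw p | ∀ x : X.obj.V, X.obj.ρ g x = x} ∈ 𝓝 (1 : Iw p) :=
    hopen.mem_nhds (by intro x; simp)
  exact Iw.exists_level_subset_of_mem_nhds h1

/-- The kernel of the action of `U` on a FINITE object of `B^temp(U)` contains a level box.
[cite: MochizukiSemiAnbd2006, Def 2.3(iii) p.25] -/
theorem exists_level_acts_trivially_E (X : BTemp (IwU p)) [Finite X.obj.V] :
    ∃ n : ℕ, ∀ g : IwU p, IwU.toMod n g = 1 → ∀ x : X.obj.V, X.obj.ρ g x = x := by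
  have hopen : IsOpen {g : IwU p | ∀ x : X.obj.V, X.obj.ρ g x = x} := by
    have : {g : IwU p | ∀ x : X.obj.V, X.obj.ρ g x = x} = ⋂ x : X.obj.V, {g : IwU p | X.obj.ρ g x = x} := by
      ext g; simp
    rw [this]
    exact isOpen_iInter_of_finite fun x => X.property.2 x
  have h1 : {g : IwU p | ∀ x : X.obj.V, X.obj.ρ g x = x} ∈ 𝓝 (1 : IwU p) :=
    hopen.mem_nhds (by intro x; simp)
  exact IwU.exists_level_subset_of_mem_nhds h1

/-- **`𝒢₁` is quasi-coherent** (Def. 2.3 (iii)): given finite coverings of the two constituents, the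
level-`n` approximator for `n` large splits both. [cite: MochizukiSemiAnbd2006, Def 2.3(iii) p.25] -/
theorem loopGraph_isQuasiCoherent : (loopGraph p).IsQuasiCoherent := by
  intro M HV HE hV hE
  haveI : Finite (HV PUnit.unit).obj.V := (hV PUnit.unit).2
  haveI : Finite (HE ⟨0⟩).obj.V := (hE ⟨0⟩).2
  obtain ⟨n₁, hn₁⟩ := exists_level_acts_trivially_V p (HV PUnit.unit)
  obtain ⟨n₂, hn₂⟩ := exists_level_acts_trivially_E p (HE ⟨0⟩)
  refine ⟨approx p (max n₁ n₂), ?_, ?_⟩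
  · rintro ⟨⟩ g hg x
    exact hn₁ g (Iw.toMod_eq_one_mono (le_max_left _ _) g hg) x
  · rintro ⟨e⟩ g hg x
    obtain rfl : e = 0 := Subsingleton.elim _ _
    exact hn₂ g (IwU.toMod_eq_one_mono (le_max_right _ _) g hg) x

/-- **`𝒢₁` is totally elevated** (Def. 2.4 (i)): at level `M` the translation subgroup of `P_M` has
order `p^M ≥ M` and meets no conjugate of either branch image. [cite: MochizukiSemiAnbd2006, Def 2.4(i) p.25] -/
theorem loopGraph_isTotallyElevated : (loopGraph p).IsTotallyElevated := by
  intro v M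
  refine ⟨approx p M, approx_isPiOneEpimorphic p M, IwMod.transl, ?_, ?_⟩
  · exact (Nat.lt_pow_self (Fact.out : p.Prime).one_lt).le.trans (IwMod.card_transl (p := p) (n := M)).ge
  · intro b h g
    exact IwMod.transl_inf_conj_range_brMod _ g

end IwahoriWitness

end Literature.AnabelianGeometry.SemiGraphs

end
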